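import Literature.Analysis.FluidPDE.TorusNSGevreyBootstrap
import Summits.AnomalousDissipation.AnomalousDissipation.Theorems.BaireTransferDenseLoudDesignerForcesErgodicH2Smoothing

/-!
# Gevrey-class smoothing along classical NS trajectories with a trigonometric-polynomial force
# (tools stub E9 `stub_gevreySmoothingTools` of block N, line `ergodic-budget-selection-closing`,
# crux `BaireTransfer.DenseLoudDesignerForces`, stmt-AnomalousDissipation-1143)

Summit-side wrapper of the Literature theorem
`Torus.IsClassicalNSSolutionOn.gevrey_of_gradNormSq_le`
(`Literature/Analysis/FluidPDE/TorusNSGevreyBootstrap.lean`; Foias–Temam, J. Funct. Anal. 87 (1989),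
Thm 1.1, run with truncated Gevrey weights on the lattice `ℤ³`): a classical solution of the
Navier–Stokes system on `T³` with viscosity `ν > 0`, steady force `realTrigPoly S₀ Fc`, zero-mean
slices and enstrophy `≤ E₁` on a window `[a, a + τ]` is, at the end of the window, in a Gevrey class
`∑_{k ∈ S} e^{2σ|k|} ‖û(a + τ, k)‖² ≤ C` with `σ > 0`, `C` depending only on `(ν, E₁, τ, S₀, Fc)` —
the universal interior-regularity tool of block N (smooth model of the NS semiflow): it feeds the
compactness of Gevrey balls (E10), `V`-data existence by approximation (E7) and the enlarged phase (P1).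
The force hypothesis of the Literature theorem (`∑_{|k|≤R} e^{2τ|k|} |k|² ‖f̂(k)‖² ≤ F`) holds with the
finite constant `F = ∑_{k ∈ S₀ ∪ −S₀} e^{2τ|k|} |k|² ‖f̂(k)‖²`, the trigonometric polynomial being
band-limited to `S₀ ∪ −S₀` (`Torus.mFourierCoeff_realTrigPoly_eq_zero_of_not_mem`).

Reference: C. Foias, R. Temam, *Gevrey class regularity for the solutions of the Navier–Stokes
equations*, J. Funct. Anal. 87 (1989) 359–369, Thm 1.1.
-/

-- `Summit.<Summit>.<Problem>` is the tree's mandated summit-side namespace (CONVENTIONS §2); for this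
-- single-conjunct summit the two coincide, so the duplicate is deliberate.
set_option linter.dupNamespace false

noncomputable section

open scoped BigOperators Topology ENNReal InnerProductSpace
open Filter Set Function MeasureTheory

namespace Summit.AnomalousDissipation.AnomalousDissipation.Theorems.DenseLoudDesignerForces.Ergodic

open Literature.Analysis.FunctionSpaces Literature.Analysis.FunctionSpaces.Torus
open Literature.Analysis.FluidPDE Literature.Analysis.FluidPDE.Torus

/-- **Tools stub E9 (`stub_gevreySmoothingTools`): Foias–Temam Gevrey smoothing on `T³` with a
trigonometric-polynomial force.** For `ν > 0`, an enstrophy level `E₁`, a window length `τ > 0` and a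
force `realTrigPoly S₀ Fc` there are `σ > 0` and `C` such that every classical solution `(u, p)` on
`[a, a + τ] × T³` with zero-mean slices and `‖∇u(t)‖₂² ≤ E₁` on the window satisfies
`∑_{k ∈ S} e^{2σ|k|} ‖û(a + τ, k)‖² ≤ C` for every finite `S ⊆ ℤ³` (uniformly in `a` and in the
solution). Wrapper of `Torus.IsClassicalNSSolutionOn.gevrey_of_gradNormSq_le` with the Gevrey level
of the band-limited force `F = ∑_{S₀ ∪ −S₀} e^{2τ|k|} |k|² ‖f̂(k)‖²`. [cite: FoiasTemam1989, Thm 1.1] -/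
theorem stub_gevreySmoothingTools {ν : ℝ} (hν : 0 < ν) (E₁ τ : ℝ) (hτ : 0 < τ) (S₀ : Finset (Fin 3 → ℤ))
    (Fc : (Fin 3 → ℤ) → EuclideanSpace ℂ (Fin 3)) :
    ∃ σ : ℝ, 0 < σ ∧ ∃ C : ℝ, ∀ {a : ℝ} {u : ℝ → (UnitAddTorus (Fin 3)) → (EuclideanSpace ℝ (Fin 3))} {p : ℝ → (UnitAddTorus (Fin 3)) → ℝ},
      IsClassicalNSSolutionOn (Icc a (a + τ)) ν (fun _ => realTrigPoly S₀ Fc) u p → (∀ t ∈ Icc a (a + τ), HasZeroMean (u t)) →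
      (∀ t ∈ Icc a (a + τ), gradNormSq (u t) ≤ E₁) →
      ∀ S : Finset (Fin 3 → ℤ), ∑ k ∈ S, Real.exp (2 * σ * Real.sqrt (freqNormSq k)) *
        ‖UnitAddTorus.mFourierCoeff (EuclideanSpace.complexify ∘ u (a + τ)) k‖ ^ 2 ≤ C := by
  classical
  set T : Finset (Fin 3 → ℤ) := S₀ ∪ S₀.image (fun k => -k) with hT
  set g : (Fin 3 → ℤ) → ℝ := fun k => Real.exp (τ * Real.sqrt (freqNormSq k)) ^ 2 *
    (freqNormSq k * ‖UnitAddTorus.mFourierCoeff (EuclideanSpace.complexify ∘ realTrigPoly S₀ Fc) k‖ ^ 2) with hg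
  have hg0 : ∀ k, 0 ≤ g k := fun k => mul_nonneg (sq_nonneg _) (mul_nonneg (freqNormSq_nonneg k) (sq_nonneg _))
  have hzero : ∀ k, k ∉ T → g k = 0 := fun k hk => by
    have hk1 : k ∉ S₀ := fun h1 => hk (Finset.mem_union_left _ h1)
    have hk2 : -k ∉ S₀ := fun h2 => hk (Finset.mem_union_right _ (Finset.mem_image.2 ⟨-k, h2, neg_neg k⟩))
    simp only [hg, mFourierCoeff_realTrigPoly_eq_zero_of_not_mem Fc hk1 hk2, norm_zero]
    ring
  obtain ⟨σ, hσ, C, hC⟩ := IsClassicalNSSolutionOn.gevrey_of_gradNormSq_le (d := Fin 3) (by simp) hν E₁ τ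
    (∑ k ∈ T, g k) hτ
  refine ⟨σ, hσ, C, fun {a u p} h hzm hE S => hC h hzm hE (fun t _ R => ?_) S⟩
  show ∑ k ∈ freqBall R, g k ≤ ∑ k ∈ T, g k
  calc ∑ k ∈ freqBall R, g k = ∑ k ∈ freqBall R ∩ T, g k :=
        (Finset.sum_subset Finset.inter_subset_left fun k hkB hknot =>
          hzero k fun hkT => hknot (Finset.mem_inter.2 ⟨hkB, hkT⟩)).symm
    _ ≤ ∑ k ∈ T, g k := Finset.sum_le_sum_of_subset_of_nonneg Finset.inter_subset_right fun k _ _ => hg0 k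

end Summit.AnomalousDissipation.AnomalousDissipation.Theorems.DenseLoudDesignerForces.Ergodic

end
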